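import Literature.AnabelianGeometry.SemiGraphs.CoveringGraphIsoOver
import Literature.AnabelianGeometry.SemiGraphs.SgAToProfiniteBObj
import Literature.AnabelianGeometry.SemiGraphs.TemperedCoveringsProofs
import HarnessLib

/-!
# [SemiAnbd] Def. 3.5 (ii) in the ambient category: an arrow is a tempered covering as soon as its
# profinite reading carries an aligned point system (the abstract reduction of law L1, proof-only)

Mochizuki, *Semi-graphs of anabelioids*, Publ. RIMS **42** (2006), Def. 3.5 (i)/(ii) p. 37 (coverings
attached to objects of `B^cov(G)`; tempered coverings; "`B(G) ↪ B^temp(G)`") (kurims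
`paper:url-f33ace170ff4`). [cite: MochizukiSemiAnbd2006, Def 3.5(ii) p.37]

PROOF-ONLY packaging of the (R1) bridge law L1 route (HOME/staging/L3/L3-t3/R1-BRIDGE-SHAPES.md §5;
interface owner abc-iut-L3-t3) for ARBITRARY arrows of the ambient category `SgA` of §§4–5, making the
residual of the abstract case kernel-precise:

* `SgA.isTemperedCoveringOf_of_pointSystem` — an arrow `f : H ⟶ G` of `SgA` is a TEMPERED COVERING
  (`SgA.IsTemperedCoveringOf`) as soon as, for some representative 1-morphism `φ` and some tempered
  `S ∈ B^cov(G)`, the profinite reading `φ.toProfinite` (B2) carries a POINT SYSTEM of `S` with the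
  gluing condition (PS1), the stabiliser dictionary (PS2) and profinite point alignment (PS3) whose
  lift is bijective on vertices and edges over a proper base (`CovObj.pointIsoOver`);
* `SgA.isTemperedCoveringOf_of_pointSystem_toCovObj` — the same with `S := toCovObj A` (finite, hence
  tempered for `G` connected and countable, `FiniteIsTempered_holds`) for a finite étale covering datum
  `A ∈ B(G)`: for the cell's abstract four-clause coverings (`finiteEtale f`) bricks L1c-iso
  (`exists_pointLiftIso_of_isFiniteEtaleCoveringOf`: (PS1), (PS2), bijectivity) leave EXACTLY (PS3) —
  the profinite point alignment of the covering's 2-cells — as the input; it holds for print's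
  constructed coverings (`SgACoveringArrowTempered.lean`) and is (J1)-grade in general.

Nothing of the paper is asserted; no side taken on [IUTchIII] Cor. 3.12.
-/

noncomputable section

namespace Literature.AnabelianGeometry.SemiGraphs

open CategoryTheory
open SemiGraphOfAnabelioids ProfiniteSemiGraph

universe u

namespace SgAQuot.SgA

variable {H G : SgA.{u, u, u}} (f : H ⟶ G)

/-- **An arrow of `SgA` with an aligned point system on its profinite reading is a tempered
covering.**  For a representative 1-morphism `φ` of `f`, a tempered object `S` of
`B^cov(G.toProfinite)` and a point system `y`, `z` of `S` over the base of `f` satisfying (PS1) the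
gluing condition, (PS2) the stabiliser dictionary, (PS3) profinite point alignment, with the point lift
bijective on vertices and edges and the base proper, `f` is a tempered covering of `G`
(`CovObj.pointIsoOver` + independence of the representative). [cite: MochizukiSemiAnbd2006, Def 3.5(ii) p.37] -/
theorem isTemperedCoveringOf_of_pointSystem (φ : HomOver H.toSgA G.toSgA f.hom.hom.base)
    (hφ : homMk φ = f.hom.hom) (S : CovObj G.toSgA.toProfinite) (hS : S.IsTempered)
    (y : ∀ w : H.toSgA.graph.Vertex, (S.SV (f.hom.hom.base.vertexMap w)).obj.V)
    (z : ∀ e' : H.toSgA.graph.Edge, (S.SE (f.hom.hom.base.edgeMap e')).obj.V)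
    (hglue : S.GlueCondition φ.toProfinite.base y z) (hst : S.StabCondition φ.toProfinite y z)
    (hPA : S.PointAligned φ.toProfinite y z) (hf : SemiGraph.IsProper f.hom.hom.base)
    (hv : Function.Bijective (S.pointLift φ.toProfinite.base y z hglue).vertexMap)
    (he : Function.Bijective (S.pointLift φ.toProfinite.base y z hglue).edgeMap) :
    IsTemperedCoveringOf f :=
  (isTemperedCoveringOf_indep f φ hφ).mpr
    ⟨S, hS, ⟨S.pointIsoOver φ.toProfinite y z hglue hst hPA hf hv he⟩⟩

/-- **The same at the finite object `toCovObj A` of a finite étale covering datum `A ∈ B(G)`** (finite,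
hence tempered for `G` connected and countable): an arrow whose profinite reading carries an aligned
point system of `toCovObj A` is a tempered covering.  For the class of an abstract four-clause finite
étale covering attached to `A`, (PS1), (PS2) and the bijections are supplied by
`HomOver.exists_pointLiftIso_of_isFiniteEtaleCoveringOf`; the input that remains is (PS3).
[cite: MochizukiSemiAnbd2006, Def 3.5(ii) p.37] -/
theorem isTemperedCoveringOf_of_pointSystem_toCovObj (hc : G.toSgA.graph.IsConnected)
    (hκ : G.toSgA.graph.IsCountable) (φ : HomOver H.toSgA G.toSgA f.hom.hom.base)
    (hφ : homMk φ = f.hom.hom) (A : G.toSgA.BObj)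
    (y : ∀ w : H.toSgA.graph.Vertex,
      (G.toSgA.fibV (f.hom.hom.base.vertexMap w)).obj (A.S (f.hom.hom.base.vertexMap w)))
    (z : ∀ e' : H.toSgA.graph.Edge,
      (G.toSgA.fibE (f.hom.hom.base.edgeMap e')).obj (A.T (f.hom.hom.base.edgeMap e')))
    (hglue : (BObj.toCovObj A).GlueCondition φ.toProfinite.base y z)
    (hst : (BObj.toCovObj A).StabCondition φ.toProfinite y z)
    (hPA : (BObj.toCovObj A).PointAligned φ.toProfinite y z) (hf : SemiGraph.IsProper f.hom.hom.base)
    (hv : Function.Bijective ((BObj.toCovObj A).pointLift φ.toProfinite.base y z hglue).vertexMap)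
    (he : Function.Bijective ((BObj.toCovObj A).pointLift φ.toProfinite.base y z hglue).edgeMap) :
    IsTemperedCoveringOf f :=
  isTemperedCoveringOf_of_pointSystem f φ hφ (BObj.toCovObj A)
    (FiniteIsTempered_holds G.toSgA.toProfinite hc hκ _ (BObj.toCovObj_isFinite A)) y z hglue hst hPA
    hf hv he

end SgAQuot.SgA

end Literature.AnabelianGeometry.SemiGraphs

end
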